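import Summits.QuantumFields.YangMills.Theorems.BalabanUVNodesN19TVKernelChain

/-!
# BalabanUVNodes ∕ N19 — THE DISINTEGRATED CLASS DATUM (coarse class law ⊗ conditional fine-variable kernel): coarse MASS_cl ∧ coarse TV_cl ∧ fibrewise kernel TV carry EVERY
# bounded observable of (coarse, fine) JOINTLY; with a COMMON conditional kernel the joint observables cost NOTHING beyond the coarse matching

Cell `pub-ymgap` (HUMAN RULING D-0062 Track A ∕ D-0149 width seats), WIDTH SEAT `pub-ymgap-dag-n19-w2` (node n19 = NE7, seat 2 of 3), generation g4,
CLAIM-4 ∕ INTENT-5 (INBOX l.29842; the located successor (t5) of this seat's own g4 HANDOFF).  Route `Summits/QuantumFields/YangMills/Theses/BalabanUVNodes.lean`, key item K3⁷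
`SpineGivenEndpointR13SepCoPH` (stmt-QuantumFields-20544); filed `--kind proof --supports … --as helper`.  COUNT-NEUTRAL.  THEOREMS ONLY (0 `def`, 0 `sorry`); imports this seat's g4
file 3 `…N19TVKernelChain` (p607251: `abs_compProd_real_sub_le_of_tv`; through it files 1∕2 — `normalized_real`, `isProbabilityMeasure_normalized`, the radius arithmetic and massless-corner
lemmas — n19-c's `…N19CoreTVInvariant.core_of_mass_of_tv` and g3's `…N19TVTiltSharpLeaf.tiltedMeanMatching_of_tv_sharp ∕ _half`), Mathlib's `Measure.compProd` (`fst_compProd`,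
`compProd_smul_left`); edits nothing, re-declares nothing.

SETTING.  ONE index of classes (`T K`, `Bad K t` — the COARSE datum's), two class spaces per level: coarse `Ω₁ K` and fine `Ω₂ K`.  Each run's class piece on `Ω₁ K × Ω₂ K` is
DISINTEGRATED along the coarse variable: `μA K τ ⊗ₘ κA K τ` = (coarse class law, a finite measure) ⊗ (conditional law of the fine variables given the coarse one, a Markov kernel) —
the (block-spin ∕ conditional-fluctuation) reading of a renormalisation-group class datum; likewise `μB K τ ⊗ₘ κB K τ`.  A JOINT observable is any bounded measurable
`W_K : Ω₁ K × Ω₂ K → ℝ`.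

WHAT IS PROVED ([folklore] measure theory ∕ bookkeeping over the tree's shapes).
* §1 one class: `compProd_univ_eq` (fibres carry no mass: `(μ ⊗ₘ κ)(univ) = μ(univ)`, Mathlib `fst_compProd`) · `normalized_compProd` (normalisation commutes, `compProd_smul_left`) ·
  `compProd_div_eq_normalized_compProd_real` · `abs_compProd_div_sub_zero_le_of_tv` (massless corner) · ★★ `abs_compProd_div_sub_le_of_tv` (coarse pieces TV_cl(ρ) in n19-c's normalised
  letters, kernels fibrewise σ-close, `ρ, σ ∈ [0, 1]` ⇒ the disintegrated pieces are TV_cl(`ρ + σ − ρσ`) — file 3's `abs_compProd_real_sub_le_of_tv` after normalising; SHARP by file 3 §4).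
* §2 class level (n19-c's binder prefixes VERBATIM on the disintegrated datum, SAME `T`∕`Bad` as the coarse datum): `isFiniteMeasure_compProdPiece` · ★ `massSandwich_disintegration` (the coarse
  MASS_cl IS the joint MASS_cl — same constants, same radius) · ★★ `tvSandwich_disintegration` (radius `ρ K + σ K − ρ K σ K`) · ★★ `core_disintegration_of_mass_of_tv` (coarse MASS_cl(r) ∧
  coarse TV_cl(ρ) ∧ fibrewise kernel TV(σ) ⇒ `Spine.NE7.Core` with the COARSE constant for EVERY bounded JOINT observable, width `r K + (e^{2l₀B} − 1)(ρ K + σ K − ρ K σ K)`) ·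
  ★★ `core_disintegration_of_mass_of_tv_commonKernel` (the SAME conditional kernel in both runs — data processing at the class level: width `r K + (e^{2l₀B} − 1)ρ K`, i.e. the joint
  observables cost NOTHING beyond the coarse matching) · ★ `tiltedMeanMatching_disintegration_of_tv_sharp ∕ _half` (N14's binder for joint observables at g3's sharp ∕ half rate in the
  radius `ρ + σ − ρσ`) · `tiltedMeanMatching_disintegration_commonKernel_half` (common kernel: rate `2B·e^{2l₀B}·ρ K`, the coarse one).
READING (located; nothing proposed).  Together with files 1–4 the class-level invariant MASS_cl ∧ TV_cl is now closed under the three compositions g2 typed at the term level — independent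
blocks (`core_prod` ∕ `core_pi` ↦ files 1, 2, 4), skew ∕ fibred products (`core_sigma` ↦ file 3 §2 and this file), chains (`…CoreScaleChain` ↦ file 3 §3) — each with the bad-weight law
`1 − ∏(1 − ·)` and, for fibres and chains, the data-processing clause «a common kernel is free», which has no term-level analogue.

HONEST FRAMING.  [folklore] measure theory on hypothesis SHAPES produced by nobody; a PER-CLASS tool like n19-c's TV_cl; the runs' conditional fluctuation kernels of [Balaban1987RG1] (0.4) ∕
[Balaban1989LargeFieldI] (0.4) are NOT instantiated here (nor is their commonality between the two runs asserted — that is part of NE7's content); ZERO Bałaban content.  NE7 ∕ NE1′ NOT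
PRINTED as two-run statements for d = 4 and NOT proved; N14 ∕ N19 NOT discharged; K3⁷ OPEN, not claimed; counts UNMOVED (typed 28∕28 · discharged 5∕27 · A 5∕28); no count claim.  One
finite four-torus programme at fixed `ε`; R4 closes the conditional finite-𝕋⁴ rung `BalabanLadder.UV` only — NOT ℝ⁴, NOT OS, NOT the Yang–Mills mass gap, NOT Clay.  0 `def`; 0 `sorry`;
standard axioms.
-/

set_option autoImplicit false

noncomputable section

open MeasureTheory ProbabilityTheory
open scoped ENNReal

namespace Summit.QuantumFields.YangMills.BalabanUVNodes.N19CoreTVInvariantDisintegration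

open Summit.QuantumFields.BalabanUV.T4Continuum.NE1p.DressedMGFForm (MGFForm TiltedMeanMatching)
open Summit.QuantumFields.BalabanUV.T4Continuum.Spine.NE7 (Core)
open Summit.QuantumFields.YangMills.BalabanUVNodes.N19TVProductBlocks
open Summit.QuantumFields.YangMills.BalabanUVNodes.N19TVKernelChain (abs_compProd_real_sub_le_of_tv)
open Summit.QuantumFields.YangMills.BalabanUVNodes.N19CoreTVInvariant (core_of_mass_of_tv)
open Summit.QuantumFields.YangMills.BalabanUVNodes.N19TVTiltSharpLeaf (tiltedMeanMatching_of_tv_sharp tiltedMeanMatching_of_tv_half)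

/-! ## §1 One class: the disintegrated piece `μ ⊗ₘ κ` in the normalised letters [folklore] -/

section OneClass

variable {X Y : Type*} [MeasurableSpace X] [MeasurableSpace Y]

/-- **FIBRES CARRY NO MASS**: `(μ ⊗ₘ κ)(univ) = μ(univ)` for a Markov kernel (Mathlib `Measure.fst_compProd`). [folklore] -/
theorem compProd_univ_eq (μ : Measure X) [SFinite μ] (κ : Kernel X Y) [IsMarkovKernel κ] : (μ ⊗ₘ κ) Set.univ = μ Set.univ := by
  rw [← Measure.fst_univ, Measure.fst_compProd]

/-- **NORMALISATION COMMUTES WITH DISINTEGRATION**: `(m⁻¹ • μ) ⊗ₘ κ = m⁻¹ • (μ ⊗ₘ κ)`, `m = μ(univ) = (μ ⊗ₘ κ)(univ)` (Mathlib `Measure.compProd_smul_left`). [folklore] -/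
theorem normalized_compProd (μ : Measure X) [IsFiniteMeasure μ] (κ : Kernel X Y) [IsMarkovKernel κ] :
    ((μ Set.univ)⁻¹ • μ) ⊗ₘ κ = ((μ ⊗ₘ κ) Set.univ)⁻¹ • (μ ⊗ₘ κ) := by
  rw [Measure.compProd_smul_left, compProd_univ_eq]

/-- The normalised letters of a disintegrated piece ARE the real letters of the disintegration of the normalised coarse law. [folklore] -/
theorem compProd_div_eq_normalized_compProd_real (μ : Measure X) [IsFiniteMeasure μ] (κ : Kernel X Y) [IsMarkovKernel κ] (S : Set (X × Y)) :
    (μ ⊗ₘ κ).real S / (μ ⊗ₘ κ).real Set.univ = (((μ Set.univ)⁻¹ • μ) ⊗ₘ κ).real S := by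
  rw [normalized_compProd, normalized_real]

/-- The massless corner: if run A's coarse piece is massless, the normalised gap of the disintegrated pieces is at most `ρ + σ − ρσ`. [folklore] -/
theorem abs_compProd_div_sub_zero_le_of_tv {μ μ' : Measure X} [IsFiniteMeasure μ] [IsFiniteMeasure μ'] {κ κ' : Kernel X Y} [IsMarkovKernel κ]
    [IsMarkovKernel κ'] {ρ σ : ℝ} (hρ : 0 ≤ ρ) (hρ1 : ρ ≤ 1) (hσ : 0 ≤ σ) (hσ1 : σ ≤ 1)
    (h₁ : ∀ S : Set X, MeasurableSet S → |μ'.real S / μ'.real Set.univ - μ.real S / μ.real Set.univ| ≤ ρ) (hA : μ Set.univ = 0)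
    (S : Set (X × Y)) :
    |(μ' ⊗ₘ κ').real S / (μ' ⊗ₘ κ').real Set.univ - (μ ⊗ₘ κ).real S / (μ ⊗ₘ κ).real Set.univ| ≤ ρ + σ - ρ * σ := by
  have hunit' := div_univ_mem_unit (μ' ⊗ₘ κ') S
  rw [div_univ_eq_zero_of_mass (μ ⊗ₘ κ) (by rw [compProd_univ_eq]; exact hA), sub_zero, abs_of_nonneg hunit'.1]
  by_cases hB : μ' Set.univ = 0
  · rw [div_univ_eq_zero_of_mass (μ' ⊗ₘ κ') (by rw [compProd_univ_eq]; exact hB)]; exact prodRadius_nonneg hρ hσ hσ1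
  · rw [le_antisymm hρ1 (one_le_radius_of_mass_zero hA hB h₁), prodRadius_one_left]; exact hunit'.2

/-- ★★ **TV_cl OF DISINTEGRATED CLASS PIECES.**  Coarse pieces `μ, μ′` (finite measures) TV_cl(ρ) in n19-c's normalised letters; conditional kernels `κ, κ′` (Markov) fibrewise `σ`-close on
every set; `ρ, σ ∈ [0, 1]` ⇒ the disintegrated pieces `μ ⊗ₘ κ`, `μ′ ⊗ₘ κ′` are TV_cl(`ρ + σ − ρσ`) — normalise (`normalized_compProd`) and apply file 3's `abs_compProd_real_sub_le_of_tv`;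
massless corners included.  SHARP (file 3 §4 ∕ file 2 §1). [folklore] -/
theorem abs_compProd_div_sub_le_of_tv {μ μ' : Measure X} [IsFiniteMeasure μ] [IsFiniteMeasure μ'] {κ κ' : Kernel X Y} [IsMarkovKernel κ] [IsMarkovKernel κ']
    {ρ σ : ℝ} (hρ : 0 ≤ ρ) (hρ1 : ρ ≤ 1) (hσ : 0 ≤ σ) (hσ1 : σ ≤ 1)
    (h₁ : ∀ S : Set X, MeasurableSet S → |μ'.real S / μ'.real Set.univ - μ.real S / μ.real Set.univ| ≤ ρ)
    (h₂ : ∀ x, ∀ S : Set Y, MeasurableSet S → |(κ' x).real S - (κ x).real S| ≤ σ) {S : Set (X × Y)} (hS : MeasurableSet S) :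
    |(μ' ⊗ₘ κ').real S / (μ' ⊗ₘ κ').real Set.univ - (μ ⊗ₘ κ).real S / (μ ⊗ₘ κ).real Set.univ| ≤ ρ + σ - ρ * σ := by
  by_cases hA : μ Set.univ = 0
  · exact abs_compProd_div_sub_zero_le_of_tv hρ hρ1 hσ hσ1 h₁ hA S
  by_cases hB : μ' Set.univ = 0
  · rw [abs_sub_comm]
    exact abs_compProd_div_sub_zero_le_of_tv hρ hρ1 hσ hσ1 (fun S hS => by rw [abs_sub_comm]; exact h₁ S hS)
      (κ := κ') (κ' := κ) hB S
  haveI := isProbabilityMeasure_normalized hA; haveI := isProbabilityMeasure_normalized hB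
  have h₁' : ∀ S : Set X, MeasurableSet S → |((μ' Set.univ)⁻¹ • μ').real S - ((μ Set.univ)⁻¹ • μ).real S| ≤ ρ := fun S hS => by
    rw [normalized_real, normalized_real]; exact h₁ S hS
  rw [compProd_div_eq_normalized_compProd_real μ' κ', compProd_div_eq_normalized_compProd_real μ κ]
  exact abs_compProd_real_sub_le_of_tv hσ hσ1 h₁' h₂ hS

end OneClass

/-! ## §2 Class level: the disintegrated datum on the coarse datum's index [folklore] -/

section Blocks

variable {ι : Type*} [DecidableEq ι] {Ω₁ Ω₂ : ℕ → Type*} [∀ K, MeasurableSpace (Ω₁ K)] [∀ K, MeasurableSpace (Ω₂ K)]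
  {l₀ vol B : ℝ} {T : ℕ → Finset ι} {Bad : ℕ → ℝ → Finset ι}
  {μA μB : ∀ K, ι → Measure (Ω₁ K)} {κA κB : ∀ K, ι → Kernel (Ω₁ K) (Ω₂ K)} [∀ K τ, IsMarkovKernel (κA K τ)] [∀ K τ, IsMarkovKernel (κB K τ)]
  {r ρ σ δ : ℕ → ℝ} {W : ∀ K, Ω₁ K × Ω₂ K → ℝ} {P Q : ℕ → ℝ → ι → ℝ}

omit [DecidableEq ι] in
/-- The disintegrated class pieces are finite on the classes. [folklore] -/
theorem isFiniteMeasure_compProdPiece (hfin : ∀ K, ∀ τ ∈ T K, IsFiniteMeasure (μA K τ)) :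
    ∀ K, ∀ τ ∈ T K, IsFiniteMeasure (μA K τ ⊗ₘ κA K τ) := fun K τ hτ => by
  haveI := hfin K τ hτ
  infer_instance

/-- ★ **THE COARSE MASS_cl IS THE JOINT MASS_cl** (same constants, same radius; fibres carry no mass): n19-c's `ℝ≥0∞` letters, `core_of_mass_of_tv`'s hypothesis `hM` VERBATIM on the
disintegrated datum. [folklore] -/
theorem massSandwich_disintegration (hfinA : ∀ K, ∀ τ ∈ T K, IsFiniteMeasure (μA K τ)) (hfinB : ∀ K, ∀ τ ∈ T K, IsFiniteMeasure (μB K τ))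
    (hM : ∀ K : ℕ, ∃ c : ℝ, ∀ t : ℝ, |t| ≤ l₀ → ∀ τ ∈ T K \ Bad K t,
      ENNReal.ofReal (Real.exp (c - r K)) * μA K τ Set.univ ≤ μB K τ Set.univ ∧
        μB K τ Set.univ ≤ ENNReal.ofReal (Real.exp (c + r K)) * μA K τ Set.univ) :
    ∀ K : ℕ, ∃ c : ℝ, ∀ t : ℝ, |t| ≤ l₀ → ∀ τ ∈ T K \ Bad K t,
      ENNReal.ofReal (Real.exp (c - r K)) * (μA K τ ⊗ₘ κA K τ) Set.univ ≤ (μB K τ ⊗ₘ κB K τ) Set.univ ∧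
        (μB K τ ⊗ₘ κB K τ) Set.univ ≤ ENNReal.ofReal (Real.exp (c + r K)) * (μA K τ ⊗ₘ κA K τ) Set.univ := by
  intro K
  obtain ⟨c, hc⟩ := hM K
  refine ⟨c, fun t ht τ hτ => ?_⟩
  have hτT : τ ∈ T K := (Finset.mem_sdiff.1 hτ).1
  haveI := hfinA K τ hτT; haveI := hfinB K τ hτT
  rw [compProd_univ_eq, compProd_univ_eq]
  exact hc t ht τ hτ

/-- ★★ **TV_cl OF THE DISINTEGRATED DATUM** (`core_of_mass_of_tv`'s hypothesis `hTV` VERBATIM): coarse TV_cl(ρ) and fibrewise kernel closeness `σ` on the good classes (`ρ K, σ K ∈ [0, 1]`) ⇒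
TV_cl(`ρ K + σ K − ρ K σ K`) for the disintegrated pieces. [folklore] -/
theorem tvSandwich_disintegration (hfinA : ∀ K, ∀ τ ∈ T K, IsFiniteMeasure (μA K τ)) (hfinB : ∀ K, ∀ τ ∈ T K, IsFiniteMeasure (μB K τ))
    (hρ : ∀ K, 0 ≤ ρ K ∧ ρ K ≤ 1) (hσ : ∀ K, 0 ≤ σ K ∧ σ K ≤ 1)
    (hTV : ∀ (K : ℕ) (t : ℝ), |t| ≤ l₀ → ∀ τ ∈ T K \ Bad K t, ∀ S : Set (Ω₁ K), MeasurableSet S →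
      |(μB K τ).real S / (μB K τ).real Set.univ - (μA K τ).real S / (μA K τ).real Set.univ| ≤ ρ K)
    (hK : ∀ (K : ℕ) (t : ℝ), |t| ≤ l₀ → ∀ τ ∈ T K \ Bad K t, ∀ x, ∀ S : Set (Ω₂ K), MeasurableSet S →
      |(κB K τ x).real S - (κA K τ x).real S| ≤ σ K) :
    ∀ (K : ℕ) (t : ℝ), |t| ≤ l₀ → ∀ τ ∈ T K \ Bad K t, ∀ S : Set (Ω₁ K × Ω₂ K), MeasurableSet S →
      |(μB K τ ⊗ₘ κB K τ).real S / (μB K τ ⊗ₘ κB K τ).real Set.univ -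
          (μA K τ ⊗ₘ κA K τ).real S / (μA K τ ⊗ₘ κA K τ).real Set.univ| ≤ ρ K + σ K - ρ K * σ K := by
  intro K t ht τ hτ S hS
  have hτT : τ ∈ T K := (Finset.mem_sdiff.1 hτ).1
  haveI := hfinA K τ hτT; haveI := hfinB K τ hτT
  exact abs_compProd_div_sub_le_of_tv (hρ K).1 (hρ K).2 (hσ K).1 (hσ K).2 (hTV K t ht τ hτ) (hK K t ht τ hτ) hS

/-- ★★ **COARSE MASS_cl ∧ COARSE TV_cl ∧ FIBREWISE KERNEL TV ⇒ `Core` FOR EVERY BOUNDED JOINT OBSERVABLE, WITH THE COARSE CONSTANT.**  The disintegrated datum of two runs; a JOINT observable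
family `W_K : Ω₁ K × Ω₂ K → ℝ`, `|W| ≤ B`, with dressed class terms `P`, `Q` in MGF form on the disintegrated pieces ⇒ `Spine.NE7.Core l₀ vol T Bad P Q δ` for any width
`vol·δ_K ≥ r K + (e^{2l₀B} − 1)·(ρ K + σ K − ρ K σ K)` (§2 ∘ n19-c `core_of_mass_of_tv`). [folklore] -/
theorem core_disintegration_of_mass_of_tv
    (hP : MGFForm B T W (fun K τ => μA K τ ⊗ₘ κA K τ) P) (hQ : MGFForm B T W (fun K τ => μB K τ ⊗ₘ κB K τ) Q)
    (hfinA : ∀ K, ∀ τ ∈ T K, IsFiniteMeasure (μA K τ)) (hfinB : ∀ K, ∀ τ ∈ T K, IsFiniteMeasure (μB K τ))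
    (hM : ∀ K : ℕ, ∃ c : ℝ, ∀ t : ℝ, |t| ≤ l₀ → ∀ τ ∈ T K \ Bad K t,
      ENNReal.ofReal (Real.exp (c - r K)) * μA K τ Set.univ ≤ μB K τ Set.univ ∧
        μB K τ Set.univ ≤ ENNReal.ofReal (Real.exp (c + r K)) * μA K τ Set.univ)
    (hρ : ∀ K, 0 ≤ ρ K ∧ ρ K ≤ 1) (hσ : ∀ K, 0 ≤ σ K ∧ σ K ≤ 1)
    (hTV : ∀ (K : ℕ) (t : ℝ), |t| ≤ l₀ → ∀ τ ∈ T K \ Bad K t, ∀ S : Set (Ω₁ K), MeasurableSet S →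
      |(μB K τ).real S / (μB K τ).real Set.univ - (μA K τ).real S / (μA K τ).real Set.univ| ≤ ρ K)
    (hK : ∀ (K : ℕ) (t : ℝ), |t| ≤ l₀ → ∀ τ ∈ T K \ Bad K t, ∀ x, ∀ S : Set (Ω₂ K), MeasurableSet S →
      |(κB K τ x).real S - (κA K τ x).real S| ≤ σ K)
    (hw : ∀ K, r K + (Real.exp (2 * (l₀ * B)) - 1) * (ρ K + σ K - ρ K * σ K) ≤ vol * δ K) :
    Core l₀ vol T Bad P Q δ :=
  core_of_mass_of_tv (ρ := fun K => ρ K + σ K - ρ K * σ K) hP hQ (massSandwich_disintegration hfinA hfinB hM)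
    (tvSandwich_disintegration hfinA hfinB hρ hσ hTV hK) hw

/-- ★★ **A COMMON CONDITIONAL KERNEL IS FREE** (data processing at the class level): if both runs disintegrate their class pieces with the SAME Markov kernels `κ K τ`, then coarse
MASS_cl(r) ∧ coarse TV_cl(ρ) already give `Core` for every bounded JOINT observable at width `vol·δ_K ≥ r K + (e^{2l₀B} − 1)·ρ K` — the joint observables cost NOTHING beyond the coarse
matching. [folklore] -/
theorem core_disintegration_of_mass_of_tv_commonKernel {κ : ∀ K, ι → Kernel (Ω₁ K) (Ω₂ K)} [∀ K τ, IsMarkovKernel (κ K τ)]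
    (hP : MGFForm B T W (fun K τ => μA K τ ⊗ₘ κ K τ) P) (hQ : MGFForm B T W (fun K τ => μB K τ ⊗ₘ κ K τ) Q)
    (hfinA : ∀ K, ∀ τ ∈ T K, IsFiniteMeasure (μA K τ)) (hfinB : ∀ K, ∀ τ ∈ T K, IsFiniteMeasure (μB K τ))
    (hM : ∀ K : ℕ, ∃ c : ℝ, ∀ t : ℝ, |t| ≤ l₀ → ∀ τ ∈ T K \ Bad K t,
      ENNReal.ofReal (Real.exp (c - r K)) * μA K τ Set.univ ≤ μB K τ Set.univ ∧
        μB K τ Set.univ ≤ ENNReal.ofReal (Real.exp (c + r K)) * μA K τ Set.univ)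
    (hρ : ∀ K, 0 ≤ ρ K ∧ ρ K ≤ 1)
    (hTV : ∀ (K : ℕ) (t : ℝ), |t| ≤ l₀ → ∀ τ ∈ T K \ Bad K t, ∀ S : Set (Ω₁ K), MeasurableSet S →
      |(μB K τ).real S / (μB K τ).real Set.univ - (μA K τ).real S / (μA K τ).real Set.univ| ≤ ρ K)
    (hw : ∀ K, r K + (Real.exp (2 * (l₀ * B)) - 1) * ρ K ≤ vol * δ K) :
    Core l₀ vol T Bad P Q δ :=
  core_disintegration_of_mass_of_tv (σ := fun _ => 0) hP hQ hfinA hfinB hM hρ (fun _ => ⟨le_rfl, zero_le_one⟩) hTV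
    (fun K t _ τ _ x S _ => by rw [sub_self, abs_zero]) (fun K => by simpa using hw K)

/-- ★ **N14's BINDER FOR JOINT OBSERVABLES OF THE DISINTEGRATED DATUM, SHARP RATE** `2B·κg∕(1 + (κ − 1)g)`, `κ = e^{2l₀B}`, `g_K = ρ K + σ K − ρ K σ K`
(§2 ∘ g3 `tiltedMeanMatching_of_tv_sharp`). [folklore] -/
theorem tiltedMeanMatching_disintegration_of_tv_sharp
    (hfinA : ∀ K, ∀ τ ∈ T K, IsFiniteMeasure (μA K τ)) (hfinB : ∀ K, ∀ τ ∈ T K, IsFiniteMeasure (μB K τ))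
    (hB : 0 ≤ B) (hWm : ∀ K, Measurable (W K)) (hWb : ∀ K ω, |W K ω| ≤ B) (hρ : ∀ K, 0 ≤ ρ K ∧ ρ K ≤ 1) (hσ : ∀ K, 0 ≤ σ K ∧ σ K ≤ 1)
    (hTV : ∀ (K : ℕ) (t : ℝ), |t| ≤ l₀ → ∀ τ ∈ T K \ Bad K t, ∀ S : Set (Ω₁ K), MeasurableSet S →
      |(μB K τ).real S / (μB K τ).real Set.univ - (μA K τ).real S / (μA K τ).real Set.univ| ≤ ρ K)
    (hK : ∀ (K : ℕ) (t : ℝ), |t| ≤ l₀ → ∀ τ ∈ T K \ Bad K t, ∀ x, ∀ S : Set (Ω₂ K), MeasurableSet S →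
      |(κB K τ x).real S - (κA K τ x).real S| ≤ σ K) :
    TiltedMeanMatching l₀ T Bad W (fun K τ => μA K τ ⊗ₘ κA K τ) W (fun K τ => μB K τ ⊗ₘ κB K τ) fun K =>
      2 * B * (Real.exp (2 * (l₀ * B)) * (ρ K + σ K - ρ K * σ K) / (1 + (Real.exp (2 * (l₀ * B)) - 1) * (ρ K + σ K - ρ K * σ K))) :=
  tiltedMeanMatching_of_tv_sharp (ρ := fun K => ρ K + σ K - ρ K * σ K) (isFiniteMeasure_compProdPiece hfinA) (isFiniteMeasure_compProdPiece hfinB)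
    hB hWm hWb (tvSandwich_disintegration hfinA hfinB hρ hσ hTV hK)

/-- The same at g3's HALF rate `2B·e^{2l₀B}·(ρ K + σ K − ρ K σ K)` — summable once `Σ (ρ K + σ K) < ∞`. [folklore] -/
theorem tiltedMeanMatching_disintegration_of_tv_half
    (hfinA : ∀ K, ∀ τ ∈ T K, IsFiniteMeasure (μA K τ)) (hfinB : ∀ K, ∀ τ ∈ T K, IsFiniteMeasure (μB K τ))
    (hB : 0 ≤ B) (hWm : ∀ K, Measurable (W K)) (hWb : ∀ K ω, |W K ω| ≤ B) (hρ : ∀ K, 0 ≤ ρ K ∧ ρ K ≤ 1) (hσ : ∀ K, 0 ≤ σ K ∧ σ K ≤ 1)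
    (hTV : ∀ (K : ℕ) (t : ℝ), |t| ≤ l₀ → ∀ τ ∈ T K \ Bad K t, ∀ S : Set (Ω₁ K), MeasurableSet S →
      |(μB K τ).real S / (μB K τ).real Set.univ - (μA K τ).real S / (μA K τ).real Set.univ| ≤ ρ K)
    (hK : ∀ (K : ℕ) (t : ℝ), |t| ≤ l₀ → ∀ τ ∈ T K \ Bad K t, ∀ x, ∀ S : Set (Ω₂ K), MeasurableSet S →
      |(κB K τ x).real S - (κA K τ x).real S| ≤ σ K) :
    TiltedMeanMatching l₀ T Bad W (fun K τ => μA K τ ⊗ₘ κA K τ) W (fun K τ => μB K τ ⊗ₘ κB K τ) fun K =>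
      2 * B * Real.exp (2 * (l₀ * B)) * (ρ K + σ K - ρ K * σ K) :=
  tiltedMeanMatching_of_tv_half (ρ := fun K => ρ K + σ K - ρ K * σ K) (isFiniteMeasure_compProdPiece hfinA) (isFiniteMeasure_compProdPiece hfinB)
    hB hWm hWb (tvSandwich_disintegration hfinA hfinB hρ hσ hTV hK)

/-- **COMMON KERNEL, N14's BINDER AT THE COARSE RATE** `2B·e^{2l₀B}·ρ K`: with the same conditional kernels in both runs the joint observables' tilted means are matched at the coarse
pieces' own half rate. [folklore] -/
theorem tiltedMeanMatching_disintegration_commonKernel_half {κ : ∀ K, ι → Kernel (Ω₁ K) (Ω₂ K)} [∀ K τ, IsMarkovKernel (κ K τ)]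
    (hfinA : ∀ K, ∀ τ ∈ T K, IsFiniteMeasure (μA K τ)) (hfinB : ∀ K, ∀ τ ∈ T K, IsFiniteMeasure (μB K τ))
    (hB : 0 ≤ B) (hWm : ∀ K, Measurable (W K)) (hWb : ∀ K ω, |W K ω| ≤ B) (hρ : ∀ K, 0 ≤ ρ K ∧ ρ K ≤ 1)
    (hTV : ∀ (K : ℕ) (t : ℝ), |t| ≤ l₀ → ∀ τ ∈ T K \ Bad K t, ∀ S : Set (Ω₁ K), MeasurableSet S →
      |(μB K τ).real S / (μB K τ).real Set.univ - (μA K τ).real S / (μA K τ).real Set.univ| ≤ ρ K) :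
    TiltedMeanMatching l₀ T Bad W (fun K τ => μA K τ ⊗ₘ κ K τ) W (fun K τ => μB K τ ⊗ₘ κ K τ) fun K =>
      2 * B * Real.exp (2 * (l₀ * B)) * ρ K := by
  have h := tiltedMeanMatching_disintegration_of_tv_half (κA := κ) (κB := κ) (σ := fun _ => 0) hfinA hfinB hB hWm hWb hρ
    (fun _ => ⟨le_rfl, zero_le_one⟩) hTV (fun K t _ τ _ x S _ => by rw [sub_self, abs_zero])
  simpa using h

end Blocks

end Summit.QuantumFields.YangMills.BalabanUVNodes.N19CoreTVInvariantDisintegration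

end
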